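import Summits.QuantumFields.YangMills.Theorems.FemtoTransferGapOneSiteScaling
import Summits.QuantumFields.YangMills.Theorems.FemtoTransferGapLevelsPos
import Summits.QuantumFields.YangMills.Theorems.LuscherReductionOneSiteLevelsClosed

/-!
# Crux `FixedLatticeLaw` (stmt-QuantumFields-23943 = tree leaf `FemtoGapFixedLattice`) — the RESTRICT half of the registered skeleton is a
# theorem: the one-site law at the scaled coupling `L³β`; and the leaf ⟸ exactly the fixed-lattice constant-mode reduction

Lead seat `ym-line-fcl-p1` (2026-08-28), after the route owner's evidence file `FixedLatticeLaw_reduction.lean` (planner ym-idea-1 g2, who never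
proposes).  The registered skeleton `Cruxes.FixedLatticeLaw.Birth` (stubs `stub_fixedLReduction` — OPEN, the whole difficulty — and
`stub_oneSiteAtScaledCoupling`) composes `FixedLatticeLaw ⇐ FixedLReduction ∧ OneSiteAtScaledCoupling`.  Here, with the statements SPELLED OUT
(no skeleton-local `def`s in a proof file; hence landed as a helper, not for stub credit):

* `oneSiteAtScaledCoupling` — `μ₀(L³β) > 0` and `μ₁(L³β) ≤ exp(−(ε₁λ_b(β) − Cλ_b(β)²)/L)·μ₀(L³β)` for `β ≥ β₀`: crux ONE (`oneSiteLevels_proof`,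
  `k = 1`, upper half) at coupling `L³β` and `λ_b(L³β) = λ_b(β)/L` (`bareLambda_cube_mul`) — the verbatim body of `stub_oneSiteAtScaledCoupling`
  up to writing the coupling as `(L:ℝ)^3 * β`;
* `femtoGapFixedLattice_of_fixedLReduction` — the leaf from the constant-mode reduction alone (`λ₁(β,L)·μ₀(L³β) ≤ e^{C_Lλ_b²/L}·μ₁(L³β)·λ₀(β,L)`,
  spelled out as the hypothesis): divide by `μ₀ > 0`.

HONEST FRAMING: the reduction hypothesis is the fixed-`L` Born–Oppenheimer theorem for `SU(2)^{3L³}` (no proof in print for `L ≥ 2`; see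
`Cruxes/FixedLatticeLaw/NOTES.md`); nothing here proves it.  R2b1 is a RECORD rung — not infinite volume, not a mass gap, not Clay.
No definitions, no named facts, no `sorry`.
-/

set_option autoImplicit false

noncomputable section

namespace Summit.QuantumFields.YangMills.Theorems.FemtoCutoffLadder

open Real
open Summit.QuantumFields.YangMills.Theorems.FemtoTransferGap
open Literature.Analysis.OperatorTheory.YMMatrixModel

/-- ★ **The one-site law at the scaled coupling `L³β`**: `μ₀(L³β) > 0` and `μ₁(L³β) ≤ exp(−(ε₁λ_b(β) − Cλ_b(β)²)/L)·μ₀(L³β)` for `β ≥ β₀` —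
crux ONE at coupling `L³β`, `λ_b(L³β) = λ_b(β)/L`, and `Cλ_b²/L² ≤ |C|λ_b²/L`. [cite: Luscher1983, §2–§3] -/
theorem oneSiteAtScaledCoupling (L : ℕ) [NeZero L] :
    ∃ C β0 : ℝ, ∀ β : ℝ, β0 ≤ β →
      0 < levelValue su2Rep 1 ((L : ℝ) ^ 3 * β) 0 ∧
        levelValue su2Rep 1 ((L : ℝ) ^ 3 * β) 1 ≤
          Real.exp (-(luscherEps1 * bareLambda β - C * bareLambda β ^ 2) / L) * levelValue su2Rep 1 ((L : ℝ) ^ 3 * β) 0 := by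
  obtain ⟨C, B0, hONE⟩ := oneSiteLevels_proof 1
  refine ⟨|C|, max B0 1, fun β hβ => ?_⟩
  have hβ1 : 1 ≤ β := (le_max_right _ _).trans hβ
  have hβ0 : 0 < β := by linarith
  have hL1 : (1 : ℝ) ≤ L := by exact_mod_cast NeZero.one_le
  have hL : (0 : ℝ) < L := by linarith
  have hB : B0 ≤ (L : ℝ) ^ 3 * β := by
    have h1 : (1 : ℝ) ≤ (L : ℝ) ^ 3 := one_le_pow₀ hL1
    have : β ≤ (L : ℝ) ^ 3 * β := le_mul_of_one_le_left hβ0.le h1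
    exact ((le_max_left _ _).trans hβ).trans this
  obtain ⟨hpos, hup, -⟩ := hONE ((L : ℝ) ^ 3 * β) hB
  refine ⟨hpos, hup.trans (mul_le_mul_of_nonneg_right ?_ hpos.le)⟩
  rw [levelGap_one, bareLambda_cube_mul hβ0 L, Real.exp_le_exp, div_pow]
  set v : ℝ := bareLambda β with hv
  have hv2 : 0 ≤ v ^ 2 := sq_nonneg v
  have hL2 : (0 : ℝ) < (L : ℝ) ^ 2 := by positivity
  have key : C * (v ^ 2 / (L : ℝ) ^ 2) ≤ |C| * v ^ 2 / L := by
    rw [mul_div_assoc', div_le_div_iff₀ hL2 hL]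
    have h1 : C * v ^ 2 * (L : ℝ) ≤ |C| * v ^ 2 * L :=
      mul_le_mul_of_nonneg_right (mul_le_mul_of_nonneg_right (le_abs_self C) hv2) hL.le
    have h2 : |C| * v ^ 2 * (L : ℝ) ≤ |C| * v ^ 2 * (L : ℝ) ^ 2 := by
      apply mul_le_mul_of_nonneg_left _ (mul_nonneg (abs_nonneg C) hv2)
      nlinarith
    linarith
  have e1 : -(luscherEps1 * (v / L) - C * (v ^ 2 / (L : ℝ) ^ 2)) = -(luscherEps1 * v) / L + C * (v ^ 2 / (L : ℝ) ^ 2) := by ring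
  have e2 : -(luscherEps1 * v - |C| * v ^ 2) / (L : ℝ) = -(luscherEps1 * v) / L + |C| * v ^ 2 / L := by ring
  rw [e1, e2]
  linarith

/-- ★ **The fixed-lattice leaf from the constant-mode reduction alone**: if on every fixed lattice
`λ₁(β,L)·μ₀(L³β) ≤ exp(C_Lλ_b²/L)·μ₁(L³β)·λ₀(β,L)` eventually in `β` (the registered HARD stub `stub_fixedLReduction`, spelled out), then
`FemtoGapFixedLattice` (divide by `μ₀(L³β) > 0`, `oneSiteAtScaledCoupling`). [cite: Luscher1983, §3] [cite: LuscherMunster1984, §2] -/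
theorem femtoGapFixedLattice_of_fixedLReduction
    (hR : ∀ (L : ℕ) [NeZero L], ∃ C β0 : ℝ, ∀ β : ℝ, β0 ≤ β →
      secondValue su2Rep L β * levelValue su2Rep 1 ((L : ℝ) ^ 3 * β) 0 ≤
        Real.exp (C * bareLambda β ^ 2 / L) * (levelValue su2Rep 1 ((L : ℝ) ^ 3 * β) 1 * topValue su2Rep L β)) :
    FemtoGapFixedLattice := by
  intro L _
  obtain ⟨C₁, β₁, h₁⟩ := hR L
  obtain ⟨C₂, β₂, h₂⟩ := oneSiteAtScaledCoupling L
  refine ⟨|C₁| + C₂, max β₁ β₂, fun β hβ => ?_⟩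
  have H₁ := h₁ β ((le_max_left _ _).trans hβ)
  obtain ⟨hμ0, H₂⟩ := h₂ β ((le_max_right _ _).trans hβ)
  set μ0 := levelValue su2Rep 1 ((L : ℝ) ^ 3 * β) 0
  set μ1 := levelValue su2Rep 1 ((L : ℝ) ^ 3 * β) 1
  set a := secondValue su2Rep L β
  set b := topValue su2Rep L β
  set v := bareLambda β
  have hb : 0 ≤ b := (topValue_su2Rep_pos L β).le
  have hL : (0 : ℝ) < L := by exact_mod_cast NeZero.pos L
  have step : a * μ0 ≤ Real.exp (C₁ * v ^ 2 / L) * (Real.exp (-(luscherEps1 * v - C₂ * v ^ 2) / L) * μ0) * b := by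
    calc a * μ0 ≤ Real.exp (C₁ * v ^ 2 / L) * (μ1 * b) := H₁
      _ ≤ Real.exp (C₁ * v ^ 2 / L) * ((Real.exp (-(luscherEps1 * v - C₂ * v ^ 2) / L) * μ0) * b) :=
          mul_le_mul_of_nonneg_left (mul_le_mul_of_nonneg_right H₂ hb) (Real.exp_pos _).le
      _ = _ := by ring
  have hE : Real.exp (C₁ * v ^ 2 / L) * Real.exp (-(luscherEps1 * v - C₂ * v ^ 2) / L) ≤
      Real.exp (-(luscherEps1 * v - (|C₁| + C₂) * v ^ 2) / L) := by
    rw [← Real.exp_add, Real.exp_le_exp, ← add_div, div_le_div_iff_of_pos_right hL]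
    have : C₁ * v ^ 2 ≤ |C₁| * v ^ 2 := mul_le_mul_of_nonneg_right (le_abs_self _) (sq_nonneg v)
    linarith
  have key : a * μ0 ≤ (Real.exp (-(luscherEps1 * v - (|C₁| + C₂) * v ^ 2) / L) * b) * μ0 := by
    calc a * μ0 ≤ Real.exp (C₁ * v ^ 2 / L) * (Real.exp (-(luscherEps1 * v - C₂ * v ^ 2) / L) * μ0) * b := step
      _ = (Real.exp (C₁ * v ^ 2 / L) * Real.exp (-(luscherEps1 * v - C₂ * v ^ 2) / L)) * b * μ0 := by ring
      _ ≤ Real.exp (-(luscherEps1 * v - (|C₁| + C₂) * v ^ 2) / L) * b * μ0 :=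
          mul_le_mul_of_nonneg_right (mul_le_mul_of_nonneg_right hE hb) hμ0.le
  exact le_of_mul_le_mul_right key hμ0

end Summit.QuantumFields.YangMills.Theorems.FemtoCutoffLadder

end
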